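import Mathlib.GroupTheory.ResiduallyFinite
import Mathlib.GroupTheory.FreeGroup.IsFreeGroup
import Mathlib.GroupTheory.QuotientGroup.Finite
import Literature.GroupTheory.CombinatorialGroupTheory.FreeGroupResiduallyFinite

/-!
# Virtually free groups are residually finite; separating families of homomorphisms

Topic `Literature/GroupTheory/CombinatorialGroupTheory`, beside `FreeGroupResiduallyFinite.lean` (free groups
are residually finite, Lyndon–Schupp Ch. I §3). Classical closure properties of residual finiteness
(Mathlib's `Group.ResiduallyFinite`: the finite-index normal subgroups intersect trivially), written for the
abc-iut cell as the classical input (A) of [SemiAnbd] Prop. 3.6 (iii) (`TemperedPiResiduallyFinite`, layer L3,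
G10 rung 2; ROW abc-iut-L6-d6 by abc-iut-L3-lead 2026-08-25T20:34:14Z; consumers abc-iut-L3-d5 (B)(C)):
the tempered fundamental group is an inverse limit of VIRTUALLY FREE groups (finite étale Galois covering ∘
universal graph covering), hence residually finite. Contents (all PROVED, Mathlib + the tree's
`freeGroup_residuallyFinite` only; no new notion is defined):

1. `residuallyFinite_of_exists_monoidHom` — **separating families**: if every `g ≠ 1` is detected by a
   homomorphism to SOME residually finite group, `G` is residually finite (reduce to a finite quotient of the
   target; Mathlib `residuallyFinite_of_forall_exists_finite_monoidHom`); the indexed-family form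
   `residuallyFinite_of_separating_family`, the injective-hom form `residuallyFinite_of_injective`, the
   isomorphism form, and products `residuallyFinite_pi` (Mathlib has binary products only).
2. `residuallyFinite_of_index_ne_zero` — **finite-index subgroups**: a group with a residually finite
   subgroup of finite index is residually finite (a finite-index subgroup of the subgroup has finite index
   in the group, `Subgroup.index_map_subtype`; no normal core needed), and the `iff` form.
3. `residuallyFinite_subgroup_of_isFreeGroup`, `residuallyFinite_of_isFreeGroup_of_index_ne_zero`,
   `residuallyFinite_of_isFreeGroup_normal`, `residuallyFinite_of_free_by_finite`,
   `residuallyFinite_of_separating_virtuallyFree` —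
   **virtually free ⇒ residually finite**: a group with a free subgroup of finite index, in particular an
   extension of a finite group by a free group of any rank, is residually finite.
[cite: LyndonSchupp2001, Ch. I §3 (free groups are residually finite)]
-/

namespace Literature.GroupTheory.CombinatorialGroupTheory

universe u v w

variable {G : Type u} [Group G]

/-! ## 1. Separating families of homomorphisms -/

/-- **Separating homomorphisms.** If every non-trivial element of `G` has non-trivial image under some
homomorphism to a residually finite group, then `G` is residually finite (compose with a finite quotient of
the target that still sees the image). [cite: LyndonSchupp2001, Ch. I §3 (free groups are residually finite)] -/
theorem residuallyFinite_of_exists_monoidHom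
    (h : ∀ g : G, g ≠ 1 → ∃ (K : Type v) (_ : Group K) (_ : Group.ResiduallyFinite K) (f : G →* K), f g ≠ 1) :
    Group.ResiduallyFinite G := by
  refine Group.residuallyFinite_of_forall_exists_finite_monoidHom.{_, v} fun g hg => ?_
  obtain ⟨K, _, _, f, hfg⟩ := h g hg
  obtain ⟨N, hN⟩ := Group.exists_finiteIndexNormalSubgroup_notMem (f g) hfg
  haveI : Finite (K ⧸ N.toSubgroup) := Subgroup.finite_quotient_of_finiteIndex
  refine ⟨K ⧸ N.toSubgroup, inferInstance, inferInstance, (QuotientGroup.mk' N.toSubgroup).comp f, ?_⟩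
  rw [MonoidHom.comp_apply, QuotientGroup.mk'_apply, ne_eq, QuotientGroup.eq_one_iff]
  exact hN

/-- **Separating family, indexed form**: homomorphisms `fᵢ : G → Kᵢ` to residually finite groups that
jointly separate `G` from `1` make `G` residually finite (e.g. the projections of an inverse limit of
virtually free groups — the shape of [SemiAnbd] Prop. 3.6 (iii)). [cite: LyndonSchupp2001, Ch. I §3 (free groups are residually finite)] -/
theorem residuallyFinite_of_separating_family {ι : Type w} (K : ι → Type v) [∀ i, Group (K i)]
    [∀ i, Group.ResiduallyFinite (K i)] (f : ∀ i, G →* K i)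
    (hsep : ∀ g : G, g ≠ 1 → ∃ i, f i g ≠ 1) : Group.ResiduallyFinite G :=
  residuallyFinite_of_exists_monoidHom.{u, v} fun g hg => by
    obtain ⟨i, hi⟩ := hsep g hg
    exact ⟨K i, inferInstance, inferInstance, f i, hi⟩

/-- A group that embeds in a residually finite group is residually finite.
[cite: LyndonSchupp2001, Ch. I §3 (free groups are residually finite)] -/
theorem residuallyFinite_of_injective {K : Type v} [Group K] [Group.ResiduallyFinite K] (f : G →* K)
    (hf : Function.Injective f) : Group.ResiduallyFinite G :=
  residuallyFinite_of_exists_monoidHom.{u, v} fun g hg =>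
    ⟨K, inferInstance, inferInstance, f, fun h => hg (hf (by rw [h, map_one]))⟩

/-- Residual finiteness is invariant under isomorphism (either direction).
[cite: LyndonSchupp2001, Ch. I §3 (free groups are residually finite)] -/
theorem residuallyFinite_congr {K : Type v} [Group K] (e : G ≃* K) :
    Group.ResiduallyFinite G ↔ Group.ResiduallyFinite K :=
  ⟨fun _ => residuallyFinite_of_injective e.symm.toMonoidHom e.symm.injective,
    fun _ => residuallyFinite_of_injective e.toMonoidHom e.injective⟩

/-- **Products**: an arbitrary product of residually finite groups is residually finite (the projections
separate). [cite: LyndonSchupp2001, Ch. I §3 (free groups are residually finite)] -/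
theorem residuallyFinite_pi {ι : Type w} (K : ι → Type v) [∀ i, Group (K i)]
    [∀ i, Group.ResiduallyFinite (K i)] : Group.ResiduallyFinite (∀ i, K i) :=
  residuallyFinite_of_separating_family K (fun i => Pi.evalMonoidHom K i) fun g hg => by
    by_contra h
    push Not at h
    exact hg (funext fun i => h i)

/-- **Subgroups of products** (the form "a subgroup of a product of residually finite groups"):
immediate from `residuallyFinite_pi` and Mathlib's subgroup instance, recorded for consumers.
[cite: LyndonSchupp2001, Ch. I §3 (free groups are residually finite)] -/
theorem residuallyFinite_subgroup_pi {ι : Type w} (K : ι → Type v) [∀ i, Group (K i)]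
    [∀ i, Group.ResiduallyFinite (K i)] (H : Subgroup (∀ i, K i)) : Group.ResiduallyFinite H := by
  haveI := residuallyFinite_pi K
  infer_instance

/-! ## 2. Finite-index subgroups -/

/-- **A group with a residually finite subgroup of finite index is residually finite.** Given `g ≠ 1`:
if `g ∉ H`, the finite-index subgroup `H` itself excludes it; if `g ∈ H`, a finite-index subgroup of `H`
excluding `g` has finite index in `G`. [cite: LyndonSchupp2001, Ch. I §3 (free groups are residually finite)] -/
theorem residuallyFinite_of_index_ne_zero (H : Subgroup G) (hH : H.index ≠ 0)
    (hRF : Group.ResiduallyFinite H) : Group.ResiduallyFinite G := by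
  rw [Group.residuallyFinite_iff_exists_finiteIndex]
  intro g hg
  by_cases hgH : g ∈ H
  · have hg' : (⟨g, hgH⟩ : H) ≠ 1 := fun h => hg (congrArg Subtype.val h)
    obtain ⟨K, hK, hgK⟩ := (Group.residuallyFinite_iff_exists_finiteIndex.mp hRF) ⟨g, hgH⟩ hg'
    refine ⟨K.map H.subtype, ⟨?_⟩, ?_⟩
    · rw [Subgroup.index_map_subtype]
      exact mul_ne_zero hK.index_ne_zero hH
    · rintro ⟨k, hk, hkg⟩
      apply hgK
      have : k = ⟨g, hgH⟩ := Subtype.ext hkg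
      rwa [this] at hk
  · exact ⟨H, ⟨hH⟩, hgH⟩

/-- For a finite-index subgroup `H ≤ G`: `G` is residually finite iff `H` is.
[cite: LyndonSchupp2001, Ch. I §3 (free groups are residually finite)] -/
theorem residuallyFinite_iff_of_index_ne_zero (H : Subgroup G) (hH : H.index ≠ 0) :
    Group.ResiduallyFinite G ↔ Group.ResiduallyFinite H :=
  ⟨fun _ => inferInstance, residuallyFinite_of_index_ne_zero H hH⟩

/-- Normal-subgroup form: if `N ⊴ G` is residually finite and `G ⧸ N` is finite, `G` is residually finite.
[cite: LyndonSchupp2001, Ch. I §3 (free groups are residually finite)] -/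
theorem residuallyFinite_of_normal_of_finite_quotient (N : Subgroup G) [N.Normal] [Finite (G ⧸ N)]
    (hRF : Group.ResiduallyFinite N) : Group.ResiduallyFinite G := by
  haveI : N.FiniteIndex := Subgroup.finiteIndex_of_finite_quotient
  exact residuallyFinite_of_index_ne_zero N Subgroup.FiniteIndex.index_ne_zero hRF

/-! ## 3. Virtually free groups -/

/-- A FREE subgroup (presented through `IsFreeGroup`, any rank) is residually finite — the tree's
`freeGroup_residuallyFinite` transported along `IsFreeGroup.toFreeGroup` (the whole-group form is the tree's
`residuallyFinite_of_isFreeGroup` in the [EtTh]/[IUTchI] discharge files; restated here for subgroups only, to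
keep this file's imports inside `GroupTheory`). [cite: LyndonSchupp2001, Ch. I §3 (free groups are residually finite)] -/
theorem residuallyFinite_subgroup_of_isFreeGroup (H : Subgroup G) [IsFreeGroup H] :
    Group.ResiduallyFinite H :=
  haveI := freeGroup_residuallyFinite (IsFreeGroup.Generators H)
  residuallyFinite_of_injective (IsFreeGroup.toFreeGroup H).toMonoidHom (IsFreeGroup.toFreeGroup H).injective

/-- **Virtually free groups are residually finite**: a group with a FREE subgroup of finite index is
residually finite. [cite: LyndonSchupp2001, Ch. I §3 (free groups are residually finite)] -/
theorem residuallyFinite_of_isFreeGroup_of_index_ne_zero (H : Subgroup G) (hH : H.index ≠ 0)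
    [IsFreeGroup H] : Group.ResiduallyFinite G :=
  residuallyFinite_of_index_ne_zero H hH (residuallyFinite_subgroup_of_isFreeGroup H)

/-- **An extension of a finite group by a free group is residually finite**: `N ⊴ G` free (of any rank)
with `G ⧸ N` finite ⇒ `G` residually finite (the virtually free groups `Gal(H′ᵢ/𝒢)` of [SemiAnbd] Prop 3.6
(iii)'s proof are of this shape). [cite: LyndonSchupp2001, Ch. I §3 (free groups are residually finite)] -/
theorem residuallyFinite_of_isFreeGroup_normal (N : Subgroup G) [N.Normal] [Finite (G ⧸ N)]
    [IsFreeGroup N] : Group.ResiduallyFinite G :=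
  residuallyFinite_of_normal_of_finite_quotient N (residuallyFinite_subgroup_of_isFreeGroup N)

/-- Short-exact-sequence form: if `1 → F → G → Q` with `F` free (any rank), `ι` injective with image the
kernel of `π`, and the image of `π` finite, then `G` is residually finite.
[cite: LyndonSchupp2001, Ch. I §3 (free groups are residually finite)] -/
theorem residuallyFinite_of_free_by_finite {F : Type v} [Group F] [IsFreeGroup F] {Q : Type w} [Group Q]
    (ι : F →* G) (π : G →* Q) (hι : Function.Injective ι) (hexact : ι.range = π.ker)
    [Finite π.range] : Group.ResiduallyFinite G := by
  haveI : Group.ResiduallyFinite F :=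
    haveI := freeGroup_residuallyFinite (IsFreeGroup.Generators F)
    residuallyFinite_of_injective (IsFreeGroup.toFreeGroup F).toMonoidHom (IsFreeGroup.toFreeGroup F).injective
  haveI : Group.ResiduallyFinite π.ker := by
    rw [← hexact]
    exact (residuallyFinite_congr (ι.ofInjective hι)).mp inferInstance
  haveI : Finite (G ⧸ π.ker) := Finite.of_equiv π.range (QuotientGroup.quotientKerEquivRange π).symm
  exact residuallyFinite_of_normal_of_finite_quotient π.ker inferInstance

/-- **Inverse limits / separating families of virtually free groups**: a group whose non-trivial elements
are detected by homomorphisms to groups each having a free subgroup of finite index is residually finite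
— the form in which [SemiAnbd] Prop. 3.6 (iii) uses (A): `π₁^temp = lim← Gal(H′ᵢ/𝒢)` with every
`Gal(H′ᵢ/𝒢)` virtually free. [cite: LyndonSchupp2001, Ch. I §3 (free groups are residually finite)] -/
theorem residuallyFinite_of_separating_virtuallyFree {ι : Type w} (K : ι → Type v) [∀ i, Group (K i)]
    (H : ∀ i, Subgroup (K i)) (hH : ∀ i, (H i).index ≠ 0) [∀ i, IsFreeGroup (H i)]
    (f : ∀ i, G →* K i) (hsep : ∀ g : G, g ≠ 1 → ∃ i, f i g ≠ 1) : Group.ResiduallyFinite G :=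
  haveI : ∀ i, Group.ResiduallyFinite (K i) := fun i =>
    residuallyFinite_of_isFreeGroup_of_index_ne_zero (H i) (hH i)
  residuallyFinite_of_separating_family K f hsep

end Literature.GroupTheory.CombinatorialGroupTheory
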